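import Summits.QuantumFields.BalabanUV.T4Continuum.Spine.NE1p.DressedSmallFieldComponentInnerCarriersBondsSets
import Summits.QuantumFields.BalabanUV.T4Continuum.Spine.NE1p.DressedComposedChainLettersBonds
import Summits.QuantumFields.BalabanUV.T4Continuum.Support.B13AssemblyCoresEndWitness
import Summits.QuantumFields.BalabanUV.T4Continuum.Spine.NE1p.DressedSmallFieldCoresWitness

/-!
# T⁴ programme, spine estimate NE1′ (node O3b/H2) — S62's FOUR ENDs FIRE ON ANY PAIR OF RUNS: the binder lists of
# `DressedSmallFieldComponentInnerCarriersBonds[Sets].attachedPart_∕muPart_locE_le_of_coresAt_pencil_components[ ∕ componentSets]_inner_carriersBonds`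
# (the composed (B3-count) chain AT THE CARRIERS OF RECORD with print's bonds, `b₀ = 4·L^{4m′}` located; single-component AND set-valued
# pair) are JOINTLY INHABITED for EVERY `R : TwoRuns G`,
# every admissible scale `k` (`hk`), EVERY measurable potential frame `P` on `R.carriers`, every background `U`, every coarse polymer `X₀`
# and every outer rate `0 ≤ r₁` — by NE5's NULL (2.14)-cores over `P` (`B13AssemblyCoresEndWitness.nullCore`, BY NAME), the EMPTY term
# index, and LIVE letters from this lineage's `DressedComposedChainLettersBonds.letters_exist_carriers` ∕ `muLetters_exist_carriers`;
# a (t5)-type NULL witness — [Balaban1988RGII] pp. 12, 17–20 KIND, nothing of print instantiated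

Cell `pub-balaban`, sub-cell `t4`, BINDER-OWNERS row NE1′ (owner lineage t4-ne1p-p1, road P1 «RG-trajectory comparison»); crew seat
`b2b-balaban-t4-ne1p-formalise-leaf-01` (LEAF PROVER 01, generation 16); own-initiative crew W-row «S62 FIRES ON ANY PAIR OF RUNS» of
`t4/formal/NE1p/LEAVES.md` (INTENT + PROTOTYPE + STAGED `HOME/CLAIMS.log` l.25935; the typer gen 10 labels it).  ADDITIVE — imports this
lineage's S62 PART 2 `Spine/NE1p/DressedSmallFieldComponentInnerCarriersBondsSets` (p245958; → PART 1 p243495) and W110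
`Spine/NE1p/DressedComposedChainLettersBonds` (p245846; → W104), NE5 leaf-08's `Support/B13AssemblyCoresEndWitness` (`nullCore`) and crew
leaf-10's W33 `Spine/NE1p/DressedSmallFieldCoresWitness` (`hroom0`, the room `1 < 2` — reused BY NAME per the gate's dedup) ONLY;
THEOREMS ONLY (0 `def`, 0 `def … : Prop`, 0 cite) + ONE namespace-scoped `attribute [-instance]` (F-ne1pp1-g31-1, as S62); S62's FOUR ENDs
are APPLIED ONCE each BY NAME, `nullCore` ∕ `letters_exist_of_bondsPerCube` ∕ `letters_exist_carriers` ∕ `muLetters_exist_carriers` ∕ W104's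
`h229_sets_exists` BY NAME; nothing restated.

WHY THIS FILE.  A referee asks of every END whether its hypothesis list is JOINTLY SATISFIABLE ((t5)).  For the composed chain this
lineage answered it LIVE on pv22's nested tori (W69 for S51, W82 for S57 — W33's one-dimensional Gaussian cores over the TOY frame);
AT THE CARRIERS OF RECORD (S62) the frame is a `MeasPotFrame R.carriers` and the located bond count `b₀ = 4·L^{4m′}` with `L = R.F.L > 11`
is FORCED, so neither witness transfers.  This file gives the honest minimum ON ANY PAIR OF RUNS, in the pattern of NE5's
`B13TermDataWitness` ∕ `B13AssemblyCoresEndWitness` («the zero package on ANY `R`»):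
* §0 [arith] **`lettersSets_exist_of_bondsPerCube`** ∕ **`muLettersSets_exist_of_bondsPerCube`** — the located clause systems of the
  SET-VALUED pair (S62 PART 2: the (2.29) clause with the extra factor `e^{A}`) inhabited for every `0 < b₀`, all letters live (W110's
  witnesses with `ε` re-chosen by W104's `h229_sets_exists`);
* §1 the operator blocks of S62 (`hroom`, `hm`, `hN`, `hq`) for the NULL core family `fun _ _ _ => nullCore P ℂ E¹` over ANY frame `P`
  (W33's `hroom0` BY NAME, `hm_null`, `hN_null`, `hq_null` — toy letters `mq = N₀ = 1`, `bq = 0`, class centres `0`, radii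
  `(ROp, RHist, R′) = (1, 1, 2)`);
* §2 **`carriersBondsEnd_fires`** — S62 §1 APPLIED ONCE: for every `R`, `hk`, `P`, `U`, `X₀`, `0 ≤ r₁` there is `A₁ > 0` with S62 §1's
  conclusion LITERAL for the activity of the EMPTY index (`terms := ∅`, `act := 0`, `hact` by `simp`; `hadm` ∕ `hAmp` VACUOUS on `∅`;
  the NINETEEN located clauses discharged by `letters_exist_carriers (L := R.F.L) R.m′` — every letter live; pencil `w := 0`);
* §3 **`carriersBondsMuEnd_fires`** — S62 §2 (the μ-twin) APPLIED ONCE likewise, window `(μ₀, μ₁) = (1, 2)`, source `sμ = 1`, `v := 0`,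
  letters by `muLetters_exist_carriers`;
* §3b **`carriersBondsSetsEnd_fires`** ∕ **`carriersBondsSetsMuEnd_fires`** — S62 PART 2's SET-VALUED pair APPLIED ONCE each likewise
  (NONEMPTY-subset `hadm` and set-product `hAmp` vacuous on `∅`; letters from §0 at `b₀ := 4·L^{4m′}`);
* §4 `lhs_eq_zero` — HONESTY IN KERNEL: the bounded quantity of all four conclusions is `0` here (the witness is NULL: no term, no activity).
WHAT IT SHOWS ∕ DOES NOT SHOW.  SHOWS: S62's binder lists are consistent AS TYPED on every pair of runs — the operator ∕ measurability
blocks are met by a core over ANY `MeasPotFrame R.carriers`, the located (B5)-KIND clause system at `b₀ = 4·L^{4m′}` is met with live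
letters for every `(R, k)`, and the END's conclusion type-checks at the carriers' tori `tsys 4 (R.cubesPerDir (k+1))`.  DOES NOT SHOW:
anything LIVE — (B1b) `hadm` and (B3-amp) `hAmp` hold VACUOUSLY on the empty index (W69 ∕ W82 are the live witnesses of the same
hypothesis SHAPES on the nested tori); nothing about Bałaban's (2.14) densities.  0 binders instantiated on Bałaban's densities; no wall
item moves; wall v1.8 (T4-DAG v48) — words, not kind — does NOT move; R-t4r2-Q2 NOT met thereby; NE1′ ⇐ the named binders — ONE label
NEW ∕ NOT PRINTED ∕ NOT PROVED; spine PROVED 0∕9; count 9 unchanged.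
KERNEL NOTE (F-ne1pp1-g31-1, as S62 PARTS 1∕2): the conclusions RE-TYPED here mention `locE` over `TDom 4 (R.cubesPerDir (k+1))`, whose
`DecidableEq` the carriers' cone supplies structurally while S62's ENDs carry S51's classical one; the namespace-scoped
`attribute [-instance] …TwoRuns.instDecidableEqTDom` keeps the two syntactically equal (it lapses at `end`, never exported).
HONEST FRAMING.  A NULL (t5)-type consistency witness over hypothesis SHAPES on the CONSTRUCTED carriers of record; `nullCore` is NE5's toy
DATA, NOT a core of [II]; ABSOLUTE RULE honoured — nothing internally minted is cited, [folklore]∕[arith] tags on kernel facts only.  Rung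
(B)+1 on ONE finite four-torus — NOT infinite volume, NOT a mass gap, NOT OS on ℝ⁴, NOT Clay.  HONEST DEPENDENCY: continuum YM on T⁴ ⇐
BetaPertH ∧ nine spine estimates (0/9 proved); BetaPertH ⇐ (D1) ∧ (D4) ∧ CAP+tail; G-an2-4 gates asym, D1 and NE2/3/4.
-/

noncomputable section

namespace Summit.QuantumFields.BalabanUV.T4Continuum.NE1p.DressedSmallFieldComponentInnerCarriersBondsWitness

open Metric Set Complex MeasureTheory
open scoped BigOperators
open Literature.MathematicalPhysics.QuantumFieldTheory.Balaban1983to89 (GaugeGroup)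
open Literature.MathematicalPhysics.QuantumFieldTheory.Balaban1983to89.B13Resummation (locE)
open Literature.MathematicalPhysics.QuantumFieldTheory.Balaban1983to89.TreeLengthTorus (TPt TDom tsys torusTreeLen)
open Literature.MathematicalPhysics.QuantumFieldTheory.Balaban1983to89.TreeLengthTorusGeometry (TTouch tgeometry)
open Literature.MathematicalPhysics.QuantumFieldTheory.Balaban1983to89.B12TreeDecay (K₀)
open Summit.QuantumFields.BalabanUV.T4Continuum.B13HistMeasurable (MeasPotFrame B13HistM)
open Summit.QuantumFields.BalabanUV.T4Continuum.B13TermParamGaussianBi (BiCore)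
open Summit.QuantumFields.BalabanUV.T4Continuum.B13Carriers (TwoRuns)
open Summit.QuantumFields.BalabanUV.T4Continuum.B13InnerData (Bnd)
open Summit.QuantumFields.BalabanUV.T4Continuum.B13AssemblyCoresEndWitness (nullCore)
open Summit.QuantumFields.BalabanUV.T4Continuum.NE1p.DressedSmallFieldCoresWitness (hroom0)
open Literature.MathematicalPhysics.QuantumFieldTheory.Balaban1983to89.B13Geometry236 (a236)
open Summit.QuantumFields.BalabanUV.T4Continuum.NE1p.DressedSmallFieldComponentInnerCarriersBonds
  (attachedPart_locE_le_of_coresAt_pencil_components_inner_carriersBonds muPart_locE_le_of_coresAt_pencil_components_inner_carriersBonds)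
open Summit.QuantumFields.BalabanUV.T4Continuum.NE1p.DressedSmallFieldComponentInnerCarriersBondsSets
  (attachedPart_locE_le_of_coresAt_pencil_componentSets_inner_carriersBonds
    muPart_locE_le_of_coresAt_pencil_componentSets_inner_carriersBonds)
open Summit.QuantumFields.BalabanUV.T4Continuum.NE1p.DressedComposedChainLetters (h229_sets_exists)
open Summit.QuantumFields.BalabanUV.T4Continuum.NE1p.DressedComposedChainLettersBonds
  (letters_exist_of_bondsPerCube letters_exist_carriers muLetters_exist_carriers)

-- F-ne1pp1-g31-1 (see S62's header): keep S51 ∕ S57 ∕ S62's classical `DecidableEq (TDom 4 _)` in the re-typed conclusions below.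
attribute [-instance] Summit.QuantumFields.BalabanUV.T4Continuum.B13Carriers.TwoRuns.instDecidableEqTDom

variable {G : Type} [GaugeGroup G] (R : TwoRuns G) {k : ℕ}

/-! ## §0 [arith] The located clause systems of the SET-VALUED pair (S62 PART 2) are inhabited too -/

/-- **S62 PART 2 §1's LETTER SYSTEM IS CONSISTENT AT EVERY BONDS-PER-CUBE LETTER** [arith]: W110's `letters_exist_of_bondsPerCube` with the
member amplitude `ε` RE-CHOSEN by W104's `h229_sets_exists` so that the SET-VALUED (2.29) clause (extra factor `e^{A}`,
`A = ε·e^{64u_k − 5R_k}·3⁴L⁴·K₀`) holds — every other clause mentions `ε` only through `0 ≤ ε`; all letters live. -/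
theorem lettersSets_exist_of_bondsPerCube {L : ℕ} (hL : 3 ≤ L) {r₁ : ℝ} (hr₁ : 0 ≤ r₁) {b₀ : ℝ} (hb₀ : 0 < b₀) :
    ∃ δ κ α₆ Rk s t ε r R v Rkp A₀ A₁ ϱ : ℝ,
      (0 < α₆ ∧ 0 < s ∧ 0 < t ∧ 0 < ε ∧ 0 < v ∧ 0 < A₁ ∧ 0 < δ * κ) ∧
      0 ≤ A₀ ∧ 0 ≤ A₁ ∧ 0 ≤ r₁ ∧
      r₁ + 2 * (64 * Real.log 162) + 2 ≤ Rkp ∧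
      (A₀ + ϱ * A₁) * Real.exp (5 * r₁ + 1) * K₀ 64 8 * 9 * 64 ≤ 1 ∧
      0 ≤ α₆ ∧ 64 * Real.log 162 + 1 ≤ δ * κ ∧ Real.exp 1 * K₀ 64 8 * 64 * α₆ ≤ 1 ∧
      0 ≤ s ∧ s ≤ 1 ∧ 0 ≤ t ∧ 0 ≤ ε ∧ 0 ≤ v ∧
      64 * Real.log 162 ≤ Rk - 64 * (Real.exp (Rk * 5) * s * Real.exp (b₀ * t)) ∧
      r + R ≤ (Rk - 64 * (Real.exp (Rk * 5) * s * Real.exp (b₀ * t)) - 64 * Real.log 162) * ((L : ℝ) / a236 L) ∧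
      64 * Real.log 162 + 1 ≤ r ∧
      Real.exp 1 * K₀ 64 8 * 64 *
        (ε * Real.exp (64 * (Real.exp (Rk * 5) * s * Real.exp (b₀ * t)) - 5 * Rk) * ((3 : ℝ) ^ 4 * (L : ℝ) ^ 4) * K₀ 64 8 *
            Real.exp (5 * R) *
          Real.exp (ε * Real.exp (64 * (Real.exp (Rk * 5) * s * Real.exp (b₀ * t)) - 5 * Rk) * ((3 : ℝ) ^ 4 * (L : ℝ) ^ 4) *
            K₀ 64 8)) ≤ 1 ∧
      Rkp ≤ R - 64 * (v * Real.exp (R * 5)) ∧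
      2 ≤ ϱ ∧ A₀ ≤ ϱ * A₁ := by
  obtain ⟨δ, κ, α₆, Rk, s, t, -, r, R, v, Rkp, A₀, A₁, ϱ, ⟨hα₆0, hs0', ht0, -, hv0, hA₁0, hδκ⟩, hA₀, hA₁, -, hrate, hsmall, hα₆,
    hκk, h229k, hs0, hs1, ht, -, hv, hκR, hrate2, hκ, -, hRR, hϱ, hϱA⟩ := letters_exist_of_bondsPerCube hL hr₁ hb₀
  obtain ⟨ε, hε0, h229⟩ := h229_sets_exists (L := L) (by omega) Rk s b₀ t R
  exact ⟨δ, κ, α₆, Rk, s, t, ε, r, R, v, Rkp, A₀, A₁, ϱ, ⟨hα₆0, hs0', ht0, hε0, hv0, hA₁0, hδκ⟩, hA₀, hA₁, hr₁, hrate, hsmall, hα₆,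
    hκk, h229k, hs0, hs1, ht, hε0.le, hv, hκR, hrate2, hκ, h229, hRR, hϱ, hϱA⟩

/-- **… AND THE μ-TWIN's (S62 PART 2 §2)** [arith]: the same with the amplitude letter `A := A₀ + ϱ·A₁ > 0` and
`hsmall : A·e^{5r₁+1}·K₀(64,8)·9·64 ≤ 1`. -/
theorem muLettersSets_exist_of_bondsPerCube {L : ℕ} (hL : 3 ≤ L) {r₁ : ℝ} (hr₁ : 0 ≤ r₁) {b₀ : ℝ} (hb₀ : 0 < b₀) :
    ∃ δ κ α₆ Rk s t ε r R vW Rkp A : ℝ,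
      (0 < α₆ ∧ 0 < s ∧ 0 < t ∧ 0 < ε ∧ 0 < vW ∧ 0 < A ∧ 0 < δ * κ) ∧
      0 ≤ A ∧ 0 ≤ r₁ ∧
      r₁ + 2 * (64 * Real.log 162) + 2 ≤ Rkp ∧
      A * Real.exp (5 * r₁ + 1) * K₀ 64 8 * 9 * 64 ≤ 1 ∧
      0 ≤ α₆ ∧ 64 * Real.log 162 + 1 ≤ δ * κ ∧ Real.exp 1 * K₀ 64 8 * 64 * α₆ ≤ 1 ∧
      0 ≤ s ∧ s ≤ 1 ∧ 0 ≤ t ∧ 0 ≤ ε ∧ 0 ≤ vW ∧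
      64 * Real.log 162 ≤ Rk - 64 * (Real.exp (Rk * 5) * s * Real.exp (b₀ * t)) ∧
      r + R ≤ (Rk - 64 * (Real.exp (Rk * 5) * s * Real.exp (b₀ * t)) - 64 * Real.log 162) * ((L : ℝ) / a236 L) ∧
      64 * Real.log 162 + 1 ≤ r ∧
      Real.exp 1 * K₀ 64 8 * 64 *
        (ε * Real.exp (64 * (Real.exp (Rk * 5) * s * Real.exp (b₀ * t)) - 5 * Rk) * ((3 : ℝ) ^ 4 * (L : ℝ) ^ 4) * K₀ 64 8 *
            Real.exp (5 * R) *
          Real.exp (ε * Real.exp (64 * (Real.exp (Rk * 5) * s * Real.exp (b₀ * t)) - 5 * Rk) * ((3 : ℝ) ^ 4 * (L : ℝ) ^ 4) *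
            K₀ 64 8)) ≤ 1 ∧
      Rkp ≤ R - 64 * (vW * Real.exp (R * 5)) := by
  obtain ⟨δ, κ, α₆, Rk, s, t, ε, r, R, v, Rkp, A₀, A₁, ϱ, ⟨hα₆0, hs0', ht0, hε0, hv0, hA₁0, hδκ⟩, hA₀, hA₁, -, hrate, hsmall, hα₆,
    hκk, h229k, hs0, hs1, ht, hε, hv, hκR, hrate2, hκ, h229, hRR, hϱ, -⟩ := lettersSets_exist_of_bondsPerCube hL hr₁ hb₀
  have hϱA₁ : 0 < ϱ * A₁ := mul_pos (by linarith) hA₁0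
  exact ⟨δ, κ, α₆, Rk, s, t, ε, r, R, v, Rkp, A₀ + ϱ * A₁, ⟨hα₆0, hs0', ht0, hε0, hv0, by linarith, hδκ⟩, by linarith, hr₁, hrate,
    hsmall, hα₆, hκk, h229k, hs0, hs1, ht, hε, hv, hκR, hrate2, hκ, h229, hRR⟩

/-! ## §1 S62's operator blocks for the NULL core family over ANY frame `P` -/

/-- S62's mass block `hm` for the toy mass letter `mq = 1`, on any window, any background, any label type `ι`. [folklore] -/
theorem hm_null {ι : Type*} (Win : Set (ℕ → ℝ)) :
    ∀ k, ∀ g ∈ Win, ∀ (U : R.carriers.BgB) (X : R.carriers.Dom), R.carriers.scale X = k → ∀ i : ι,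
      0 < (fun (_ : ℕ) (_ : ι) (_ : R.carriers.Dom) => (1 : ℝ)) k i X :=
  fun _ _ _ _ _ _ _ => one_pos

/-- S62's normalisation block `hN` for the NULL core (`N = 1`: a.e.-strongly measurable, entire, `‖N‖ ≤ N₀ = 1`) over ANY frame `P`,
any class centres and radius. [folklore] -/
theorem hN_null (P : MeasPotFrame R.carriers) {ι : Type*} (Win : Set (ℕ → ℝ)) (ctr : ℕ → (ℕ → ℝ) → R.carriers.BgB → ℂ × B13HistM P) (R' : ℕ → ℝ) :
    ∀ k, ∀ g ∈ Win, ∀ (U : R.carriers.BgB) (X : R.carriers.Dom), R.carriers.scale X = k → ∀ i : ι,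
      (∀ o ∈ ball (ctr k g U).1 (R' k),
        AEStronglyMeasurable (((fun (_ : ℕ) (_ : ι) (_ : R.carriers.Dom) => nullCore P ℂ (EuclideanSpace ℝ (Fin 1))) k i X).N o)
          ((fun (_ : ℕ) (_ : ι) (_ : R.carriers.Dom) => nullCore P ℂ (EuclideanSpace ℝ (Fin 1))) k i X).lam) ∧
      (∀ p, DifferentiableOn ℂ
        (fun o => ((fun (_ : ℕ) (_ : ι) (_ : R.carriers.Dom) => nullCore P ℂ (EuclideanSpace ℝ (Fin 1))) k i X).N o p)
          (ball (ctr k g U).1 (R' k))) ∧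
      (∀ o ∈ ball (ctr k g U).1 (R' k), ∀ p,
        ‖((fun (_ : ℕ) (_ : ι) (_ : R.carriers.Dom) => nullCore P ℂ (EuclideanSpace ℝ (Fin 1))) k i X).N o p‖ ≤
          (fun (_ : ℕ) (_ : ι) (_ : R.carriers.Dom) => (1 : ℝ)) k i X) :=
  fun _ _ _ _ _ _ _ => ⟨fun _ _ => aestronglyMeasurable_const, fun _ => differentiableOn_const _, fun _ _ _ => by
    show ‖(1 : ℂ)‖ ≤ 1; rw [norm_one]⟩

/-- S62's exponent block `hq` for the NULL core (`q(o, p, v) = ‖v‖²`: jointly a.e.-strongly measurable, entire in `o`, margin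
`1·‖v‖² − 0 ≤ Re q`) over ANY frame `P`. [folklore] -/
theorem hq_null (P : MeasPotFrame R.carriers) {ι : Type*} (Win : Set (ℕ → ℝ)) (ctr : ℕ → (ℕ → ℝ) → R.carriers.BgB → ℂ × B13HistM P) (R' : ℕ → ℝ) :
    ∀ k, ∀ g ∈ Win, ∀ (U : R.carriers.BgB) (X : R.carriers.Dom), R.carriers.scale X = k → ∀ i : ι,
      (∀ o ∈ ball (ctr k g U).1 (R' k),
        AEStronglyMeasurable
          (Function.uncurry (((fun (_ : ℕ) (_ : ι) (_ : R.carriers.Dom) => nullCore P ℂ (EuclideanSpace ℝ (Fin 1))) k i X).q o))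
          (((fun (_ : ℕ) (_ : ι) (_ : R.carriers.Dom) => nullCore P ℂ (EuclideanSpace ℝ (Fin 1))) k i X).lam.prod volume)) ∧
      (∀ p v, DifferentiableOn ℂ
        (fun o => ((fun (_ : ℕ) (_ : ι) (_ : R.carriers.Dom) => nullCore P ℂ (EuclideanSpace ℝ (Fin 1))) k i X).q o p v)
          (ball (ctr k g U).1 (R' k))) ∧
      (∀ o ∈ ball (ctr k g U).1 (R' k), ∀ p v,
        (fun (_ : ℕ) (_ : ι) (_ : R.carriers.Dom) => (1 : ℝ)) k i X * ‖v‖ ^ 2 -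
            (fun (_ : ℕ) (_ : ι) (_ : R.carriers.Dom) => (0 : ℝ)) k i X ≤
          (((fun (_ : ℕ) (_ : ι) (_ : R.carriers.Dom) => nullCore P ℂ (EuclideanSpace ℝ (Fin 1))) k i X).q o p v).re) :=
  fun _ _ _ _ _ _ _ => ⟨fun _ _ => (Complex.measurable_ofReal.comp (measurable_snd.norm.pow_const 2)).aestronglyMeasurable,
    fun _ _ => differentiableOn_const _, fun _ _ _ v => by
      show 1 * ‖v‖ ^ 2 - 0 ≤ (((‖v‖ ^ 2 : ℝ) : ℂ)).re; rw [Complex.ofReal_re]; simp⟩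

/-! ## §2 S62 §1 FIRES on any pair of runs (table pencil) -/

open Classical in
/-- **S62 §1 `attachedPart_locE_le_of_coresAt_pencil_components_inner_carriersBonds` FIRES ON ANY PAIR OF RUNS** [NULL witness]: for every
`R : TwoRuns G`, admissible scale `hk`, frame `P`, background `U`, coarse polymer `X₀` and `0 ≤ r₁` there is `A₁ > 0` such that S62 §1's
conclusion holds LITERALLY for the activity of the EMPTY index — S62 §1 APPLIED ONCE with: NULL cores over `P` (§1's blocks), window
`univ`, class centres `0`, radii `(1, 1, 2)`, operator point `o = 0`, table `h₀ = 0`, pencil direction `w = 0`, `terms := ∅` (`hact` by `simp`,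
`hadm` ∕ `hAmp` vacuous), and ALL NINETEEN located clauses (with `b₀ = 4·L^{4m′}`, `L = R.F.L`) from `letters_exist_carriers` — live letters,
`ϱ = 2`-type radius letter and `A₀ ≤ ϱA₁` included. [folklore] -/
theorem carriersBondsEnd_fires (hk : k + 1 + R.m' ≤ R.F.m + R.K) (P : MeasPotFrame R.carriers) (U : R.carriers.BgB) (X₀ : (tsys 4 (R.cubesPerDir (k + 1))).Dom) {r₁ : ℝ} (hr₁ : 0 ≤ r₁) :
    ∃ A₁ : ℝ, 0 < A₁ ∧
      ‖locE (TTouch (d := 4) (N := R.cubesPerDir (k + 1))) (fun Z : (tsys 4 (R.cubesPerDir (k + 1))).Dom => Z.1)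
            ((fun (_ : ℂ) (_ : (tsys 4 (R.cubesPerDir (k + 1))).Dom) => (0 : ℂ)) 1) X₀.1 -
          locE (TTouch (d := 4) (N := R.cubesPerDir (k + 1))) (fun Z : (tsys 4 (R.cubesPerDir (k + 1))).Dom => Z.1)
            ((fun (_ : ℂ) (_ : (tsys 4 (R.cubesPerDir (k + 1))).Dom) => (0 : ℂ)) 0) X₀.1‖ ≤
        4 * (Real.exp 1 * 9 * 64 * K₀ 64 8 ^ 2) * A₁ * Real.exp (-(r₁ * torusTreeLen X₀.1)) := by
  obtain ⟨δ, κ, α₆, Rk, s, t, ε, r, Rout, v, Rkp, A₀, A₁, ϱ, ⟨-, -, -, -, -, hA₁0, -⟩, hA₀, hA₁, -, hrate, hsmall, hα₆, hκk, h229k,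
    hs0, hs1, ht, hε, hv, hκR, hrate2, hκ, h229, hRR, hϱ, hϱA⟩ :=
    letters_exist_carriers (L := R.F.L) (by have := R.F.hL11; omega) R.m' hr₁
  have hϱ0 : 0 ≤ ϱ := by linarith
  exact ⟨A₁, hA₁0, attachedPart_locE_le_of_coresAt_pencil_components_inner_carriersBonds R hk (P := P) (Op := ℂ)
    (Win := Set.univ) (ctr := fun _ _ _ => ((0 : ℂ), (0 : B13HistM P))) (ROp := fun _ => 1) (RHist := fun _ => 1) (R' := fun _ => 2)
    (fun _ _ _ => nullCore P ℂ (EuclideanSpace ℝ (Fin 1))) (mq := fun _ _ _ => 1) (bq := fun _ _ _ => 0) (N₀ := fun _ _ _ => 1)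
    hroom0 (hm_null R Set.univ) (hN_null R P Set.univ _ _) (hq_null R P Set.univ _ _) (g := fun _ => 0) (Set.mem_univ _)
    (U := U) (o := 0) (h₀ := 0) (w := 0) (ϱ := ϱ) (by simp) (by simp)
    (terms := fun _ => ∅) (act := fun _ _ => 0) (fun _ _ _ => by simp) X₀ hA₀ hA₁ hr₁ hrate hsmall hα₆ hκk h229k hs0 hs1 ht hε hv
    hκR hrate2 hκ h229 hRR (fun _ l hl => by simp at hl) (fun _ _ l hl => by simp at hl) hϱ hϱA⟩

/-! ## §3 S62 §2 FIRES on any pair of runs (road P1's source pencil) -/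

open Classical in
/-- **S62 §2 `muPart_locE_le_of_coresAt_pencil_components_inner_carriersBonds` FIRES ON ANY PAIR OF RUNS** [NULL witness]: as §2 for the
μ-twin — window `(μ₀, μ₁) = (1, 2)`, source `sμ = 1`, direction `v = 0`, the SEVENTEEN located clauses from `muLetters_exist_carriers`
(amplitude `A > 0`). [folklore] -/
theorem carriersBondsMuEnd_fires (hk : k + 1 + R.m' ≤ R.F.m + R.K) (P : MeasPotFrame R.carriers) (U : R.carriers.BgB) (X₀ : (tsys 4 (R.cubesPerDir (k + 1))).Dom) {r₁ : ℝ} (hr₁ : 0 ≤ r₁) :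
    ∃ A : ℝ, 0 < A ∧
      ‖locE (TTouch (d := 4) (N := R.cubesPerDir (k + 1))) (fun Z : (tsys 4 (R.cubesPerDir (k + 1))).Dom => Z.1)
            ((fun (_ : ℂ) (_ : (tsys 4 (R.cubesPerDir (k + 1))).Dom) => (0 : ℂ)) (1 : ℂ)) X₀.1 -
          locE (TTouch (d := 4) (N := R.cubesPerDir (k + 1))) (fun Z : (tsys 4 (R.cubesPerDir (k + 1))).Dom => Z.1)
            ((fun (_ : ℂ) (_ : (tsys 4 (R.cubesPerDir (k + 1))).Dom) => (0 : ℂ)) 0) X₀.1‖ ≤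
        Real.exp 1 * 9 * 64 * K₀ 64 8 ^ 2 * A * Real.exp (-(r₁ * torusTreeLen X₀.1)) * ((1 : ℝ) / (2 - 1)) := by
  obtain ⟨δ, κ, α₆, Rk, s, t, ε, r, Rout, vW, Rkp, A, ⟨-, -, -, -, -, hA0, -⟩, hA, -, hrate, hsmall, hα₆, hκk, h229k, hs0, hs1, ht, hε,
    hvW, hκR, hrate2, hκ, h229, hRR⟩ := muLetters_exist_carriers (L := R.F.L) (by have := R.F.hL11; omega) R.m' hr₁
  exact ⟨A, hA0, muPart_locE_le_of_coresAt_pencil_components_inner_carriersBonds R hk (P := P) (Op := ℂ)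
    (Win := Set.univ) (ctr := fun _ _ _ => ((0 : ℂ), (0 : B13HistM P))) (ROp := fun _ => 1) (RHist := fun _ => 1) (R' := fun _ => 2)
    (fun _ _ _ => nullCore P ℂ (EuclideanSpace ℝ (Fin 1))) (mq := fun _ _ _ => 1) (bq := fun _ _ _ => 0) (N₀ := fun _ _ _ => 1)
    hroom0 (hm_null R Set.univ) (hN_null R P Set.univ _ _) (hq_null R P Set.univ _ _) (g := fun _ => 0) (Set.mem_univ _)
    (U := U) (o := 0) (h₀ := 0) (v := 0) (μ₁ := 2) (by simp) (by simp)
    (terms := fun _ => ∅) (act := fun _ _ => 0) (fun _ _ _ => by simp) (μ₀ := 1) X₀ (sμ := 1) hA hr₁ hrate hsmall hα₆ hκk h229k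
    hs0 hs1 ht hε hvW hκR hrate2 hκ h229 hRR (fun _ l hl => by simp at hl) (fun _ _ l hl => by simp at hl) one_pos (by norm_num)
    (by simp)⟩

/-! ## §3b S62 PART 2 FIRES on any pair of runs (the SET-VALUED pair) -/

open Classical in
/-- **S62 PART 2 §1 `attachedPart_locE_le_of_coresAt_pencil_componentSets_inner_carriersBonds` FIRES ON ANY PAIR OF RUNS** [NULL witness]:
as §2, the SET-VALUED table-pencil END APPLIED ONCE — its `hadm` (NONEMPTY-subset clause) and set-product `hAmp` vacuous on `∅`, the
located clauses with the SET (2.29) factor from §0's `lettersSets_exist_of_bondsPerCube` at `b₀ := 4·L^{4m′}`. [folklore] -/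
theorem carriersBondsSetsEnd_fires (hk : k + 1 + R.m' ≤ R.F.m + R.K) (P : MeasPotFrame R.carriers) (U : R.carriers.BgB)
    (X₀ : (tsys 4 (R.cubesPerDir (k + 1))).Dom) {r₁ : ℝ} (hr₁ : 0 ≤ r₁) :
    ∃ A₁ : ℝ, 0 < A₁ ∧
      ‖locE (TTouch (d := 4) (N := R.cubesPerDir (k + 1))) (fun Z : (tsys 4 (R.cubesPerDir (k + 1))).Dom => Z.1)
            ((fun (_ : ℂ) (_ : (tsys 4 (R.cubesPerDir (k + 1))).Dom) => (0 : ℂ)) 1) X₀.1 -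
          locE (TTouch (d := 4) (N := R.cubesPerDir (k + 1))) (fun Z : (tsys 4 (R.cubesPerDir (k + 1))).Dom => Z.1)
            ((fun (_ : ℂ) (_ : (tsys 4 (R.cubesPerDir (k + 1))).Dom) => (0 : ℂ)) 0) X₀.1‖ ≤
        4 * (Real.exp 1 * 9 * 64 * K₀ 64 8 ^ 2) * A₁ * Real.exp (-(r₁ * torusTreeLen X₀.1)) := by
  have hL0 : (0 : ℝ) < (R.F.L : ℝ) := Nat.cast_pos.2 (by have := R.F.hL11; omega)
  obtain ⟨δ, κ, α₆, Rk, s, t, ε, r, Rout, v, Rkp, A₀, A₁, ϱ, ⟨-, -, -, -, -, hA₁0, -⟩, hA₀, hA₁, -, hrate, hsmall, hα₆, hκk, h229k,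
    hs0, hs1, ht, hε, hv, hκR, hrate2, hκ, h229, hRR, hϱ, hϱA⟩ :=
    lettersSets_exist_of_bondsPerCube (L := R.F.L) (by have := R.F.hL11; omega) hr₁ (b₀ := 4 * (R.F.L : ℝ) ^ (4 * R.m'))
      (by positivity)
  exact ⟨A₁, hA₁0, attachedPart_locE_le_of_coresAt_pencil_componentSets_inner_carriersBonds R hk (P := P) (Op := ℂ)
    (Win := Set.univ) (ctr := fun _ _ _ => ((0 : ℂ), (0 : B13HistM P))) (ROp := fun _ => 1) (RHist := fun _ => 1) (R' := fun _ => 2)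
    (fun _ _ _ => nullCore P ℂ (EuclideanSpace ℝ (Fin 1))) (mq := fun _ _ _ => 1) (bq := fun _ _ _ => 0) (N₀ := fun _ _ _ => 1)
    hroom0 (hm_null R Set.univ) (hN_null R P Set.univ _ _) (hq_null R P Set.univ _ _) (g := fun _ => 0) (Set.mem_univ _)
    (U := U) (o := 0) (h₀ := 0) (w := 0) (ϱ := ϱ) (by simp) (by simp)
    (terms := fun _ => ∅) (act := fun _ _ => 0) (fun _ _ _ => by simp) X₀ hA₀ hA₁ hr₁ hrate hsmall hα₆ hκk h229k hs0 hs1 ht hε hv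
    hκR hrate2 hκ h229 hRR (fun _ l hl => by simp at hl) (fun _ _ l hl => by simp at hl) hϱ hϱA⟩

open Classical in
/-- **S62 PART 2 §2 `muPart_locE_le_of_coresAt_pencil_componentSets_inner_carriersBonds` FIRES ON ANY PAIR OF RUNS** [NULL witness]: as §3
for the SET-VALUED μ-twin (letters from §0's `muLettersSets_exist_of_bondsPerCube` at `b₀ := 4·L^{4m′}`). [folklore] -/
theorem carriersBondsSetsMuEnd_fires (hk : k + 1 + R.m' ≤ R.F.m + R.K) (P : MeasPotFrame R.carriers) (U : R.carriers.BgB)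
    (X₀ : (tsys 4 (R.cubesPerDir (k + 1))).Dom) {r₁ : ℝ} (hr₁ : 0 ≤ r₁) :
    ∃ A : ℝ, 0 < A ∧
      ‖locE (TTouch (d := 4) (N := R.cubesPerDir (k + 1))) (fun Z : (tsys 4 (R.cubesPerDir (k + 1))).Dom => Z.1)
            ((fun (_ : ℂ) (_ : (tsys 4 (R.cubesPerDir (k + 1))).Dom) => (0 : ℂ)) (1 : ℂ)) X₀.1 -
          locE (TTouch (d := 4) (N := R.cubesPerDir (k + 1))) (fun Z : (tsys 4 (R.cubesPerDir (k + 1))).Dom => Z.1)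
            ((fun (_ : ℂ) (_ : (tsys 4 (R.cubesPerDir (k + 1))).Dom) => (0 : ℂ)) 0) X₀.1‖ ≤
        Real.exp 1 * 9 * 64 * K₀ 64 8 ^ 2 * A * Real.exp (-(r₁ * torusTreeLen X₀.1)) * ((1 : ℝ) / (2 - 1)) := by
  have hL0 : (0 : ℝ) < (R.F.L : ℝ) := Nat.cast_pos.2 (by have := R.F.hL11; omega)
  obtain ⟨δ, κ, α₆, Rk, s, t, ε, r, Rout, vW, Rkp, A, ⟨-, -, -, -, -, hA0, -⟩, hA, -, hrate, hsmall, hα₆, hκk, h229k, hs0, hs1, ht, hε,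
    hvW, hκR, hrate2, hκ, h229, hRR⟩ :=
    muLettersSets_exist_of_bondsPerCube (L := R.F.L) (by have := R.F.hL11; omega) hr₁ (b₀ := 4 * (R.F.L : ℝ) ^ (4 * R.m'))
      (by positivity)
  exact ⟨A, hA0, muPart_locE_le_of_coresAt_pencil_componentSets_inner_carriersBonds R hk (P := P) (Op := ℂ)
    (Win := Set.univ) (ctr := fun _ _ _ => ((0 : ℂ), (0 : B13HistM P))) (ROp := fun _ => 1) (RHist := fun _ => 1) (R' := fun _ => 2)
    (fun _ _ _ => nullCore P ℂ (EuclideanSpace ℝ (Fin 1))) (mq := fun _ _ _ => 1) (bq := fun _ _ _ => 0) (N₀ := fun _ _ _ => 1)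
    hroom0 (hm_null R Set.univ) (hN_null R P Set.univ _ _) (hq_null R P Set.univ _ _) (g := fun _ => 0) (Set.mem_univ _)
    (U := U) (o := 0) (h₀ := 0) (v := 0) (μ₁ := 2) (by simp) (by simp)
    (terms := fun _ => ∅) (act := fun _ _ => 0) (fun _ _ _ => by simp) (μ₀ := 1) X₀ (sμ := 1) hA hr₁ hrate hsmall hα₆ hκk h229k
    hs0 hs1 ht hε hvW hκR hrate2 hκ h229 hRR (fun _ l hl => by simp at hl) (fun _ _ l hl => by simp at hl) one_pos (by norm_num)
    (by simp)⟩

/-! ## §4 HONESTY IN KERNEL: the witness is NULL -/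

open Classical in
/-- The bounded quantity of §2 ∕ §3 VANISHES on this datum (no term, no activity: both `locE`'s read the zero activity) — the witness shows
joint satisfiability of S62's binder lists, nothing live. [folklore] -/
theorem lhs_eq_zero (X₀ : (tsys 4 (R.cubesPerDir (k + 1))).Dom) (σ σ' : ℂ) :
    locE (TTouch (d := 4) (N := R.cubesPerDir (k + 1))) (fun Z : (tsys 4 (R.cubesPerDir (k + 1))).Dom => Z.1)
        ((fun (_ : ℂ) (_ : (tsys 4 (R.cubesPerDir (k + 1))).Dom) => (0 : ℂ)) σ) X₀.1 -
      locE (TTouch (d := 4) (N := R.cubesPerDir (k + 1))) (fun Z : (tsys 4 (R.cubesPerDir (k + 1))).Dom => Z.1)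
        ((fun (_ : ℂ) (_ : (tsys 4 (R.cubesPerDir (k + 1))).Dom) => (0 : ℂ)) σ') X₀.1 = 0 :=
  sub_self _

end Summit.QuantumFields.BalabanUV.T4Continuum.NE1p.DressedSmallFieldComponentInnerCarriersBondsWitness

end
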